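import Summits.Parity.GeneralizedHardyLittlewood.Theorems.GreenTaoLevelTwoMNTwoProgressionAveraging

/-!
# Route `GreenTaoLevelTwo`, crux `MNTwo` (stmt-Parity-21276), line `birth`, stub `stub_mnVertical`:
# averaging over progressions in TWO variables and pigeonholing (GT 2008b §10, proof of Lemma 24)

Tool for block V4 / H3 (= AIF §10 Lemma 24 "Type II sum implies major arc") of the
`stub_mnVertical` census (B. Green, T. Tao, *Quadratic uniformity of the Möbius function*, Ann.
Inst. Fourier 58 (2008) = arXiv:math/0606087, §10, proof of Lemma 24: "For any `1 ≤ l ≤ L` and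
`1 ≤ m ≤ M` we can make the change of variables `d → d + sl`, `w → w + tm` … Averaging over `l` and
`m` … by the pigeonhole principle there exist `d, w` such that
`|𝔼_{1≤l≤L} 𝔼_{1≤m≤M} ψ((d+sl)(w+tm)) e(φ((d+sl)(w+tm))) b(d+sl) b(w+tm)| ≳ 1`").  Def-free; this
is the two-variable iterate of `…MNTwoProgressionAveraging` for `G : ℤ → ℤ → ℂ` vanishing outside
the box `[a,b] × [a',b']`, with windows `[a − |s|L, b + |s|L]`, `[a' − |t|M, b' + |t|M]`.  Summing
over the enlarged windows makes the identity EXACT (the paper's `O(ε)` boundary error disappears).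

* `sum_eq_avg_progressions₂` — `L·M·∑_{d,w} G(d,w) = ∑_{d∈Wd} ∑_{w∈Ww} ∑_{l≤L} ∑_{m≤M} G(d+sl, w+tm)`;
* `exists_large_progression₂` — some `(d,w)` in the windows has
  `L M ‖∑ G‖ ≤ #Wd · #Ww · ‖∑_{l=1}^{L} ∑_{m=1}^{M} G(d+sl, w+tm)‖`.

References: [GreenTao2008QuadraticMobius] arXiv:math/0606087 §10 (proof of Lemma 24).
-/

open Finset

namespace Summit.Parity.GeneralizedHardyLittlewood.GreenTaoLevelTwoMNTwoProgressionAveraging2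

open Summit.Parity.GeneralizedHardyLittlewood.GreenTaoLevelTwoMNTwoProgressionAveraging
  (sum_eq_avg_progressions)

/-- **Two-variable averaging identity**: for `G` vanishing outside `[a,b] × [a',b']`,
`L·M·∑_{d∈[a,b]} ∑_{w∈[a',b']} G(d,w) = ∑_{d ∈ Wd} ∑_{w ∈ Ww} ∑_{l=1}^{L} ∑_{m=1}^{M} G(d+sl, w+tm)`
with `Wd = [a−|s|L, b+|s|L]`, `Ww = [a'−|t|M, b'+|t|M]`.
[cite: GreenTao2008QuadraticMobius, §10 (proof of Lemma 24, change of variables and averaging)] -/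
theorem sum_eq_avg_progressions₂ {G : ℤ → ℤ → ℂ} {a b a' b' : ℤ}
    (hG : ∀ d w, (d ∉ Icc a b ∨ w ∉ Icc a' b') → G d w = 0) (s t : ℤ) (L M : ℕ) :
    (L : ℂ) * M * ∑ d ∈ Icc a b, ∑ w ∈ Icc a' b', G d w =
      ∑ d ∈ Icc (a - |s| * L) (b + |s| * L), ∑ w ∈ Icc (a' - |t| * M) (b' + |t| * M),
        ∑ l ∈ Icc (1 : ℕ) L, ∑ m ∈ Icc (1 : ℕ) M, G (d + s * l) (w + t * m) := by
  -- average in `w` for each `d`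
  have hw : ∀ d, (M : ℂ) * ∑ w ∈ Icc a' b', G d w =
      ∑ m ∈ Icc (1 : ℕ) M, ∑ w ∈ Icc (a' - |t| * M) (b' + |t| * M), G d (w + t * m) :=
    fun d => sum_eq_avg_progressions (f := G d) (fun w hw' => hG d w (Or.inr hw')) t M
  -- average in `d` for each (shifted) `w`
  have hd : ∀ w', (L : ℂ) * ∑ d ∈ Icc a b, G d w' =
      ∑ l ∈ Icc (1 : ℕ) L, ∑ d ∈ Icc (a - |s| * L) (b + |s| * L), G (d + s * l) w' :=
    fun w' => sum_eq_avg_progressions (f := fun d => G d w') (fun d hd' => hG d w' (Or.inl hd')) s L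
  calc (L : ℂ) * M * ∑ d ∈ Icc a b, ∑ w ∈ Icc a' b', G d w
      = (L : ℂ) * ∑ d ∈ Icc a b, ((M : ℂ) * ∑ w ∈ Icc a' b', G d w) := by
        rw [← Finset.mul_sum]; ring
    _ = (L : ℂ) * ∑ d ∈ Icc a b, ∑ m ∈ Icc (1 : ℕ) M,
          ∑ w ∈ Icc (a' - |t| * M) (b' + |t| * M), G d (w + t * m) := by
        rw [Finset.sum_congr rfl fun d _ => hw d]
    _ = ∑ m ∈ Icc (1 : ℕ) M, ∑ w ∈ Icc (a' - |t| * M) (b' + |t| * M),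
          ((L : ℂ) * ∑ d ∈ Icc a b, G d (w + t * m)) := by
        rw [Finset.sum_comm, Finset.mul_sum]
        refine Finset.sum_congr rfl fun m _ => ?_
        rw [Finset.sum_comm, Finset.mul_sum]
    _ = ∑ m ∈ Icc (1 : ℕ) M, ∑ w ∈ Icc (a' - |t| * M) (b' + |t| * M),
          ∑ l ∈ Icc (1 : ℕ) L, ∑ d ∈ Icc (a - |s| * L) (b + |s| * L),
            G (d + s * l) (w + t * m) := by
        refine Finset.sum_congr rfl fun m _ => Finset.sum_congr rfl fun w _ => hd _
    _ = ∑ d ∈ Icc (a - |s| * L) (b + |s| * L), ∑ w ∈ Icc (a' - |t| * M) (b' + |t| * M),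
          ∑ l ∈ Icc (1 : ℕ) L, ∑ m ∈ Icc (1 : ℕ) M, G (d + s * l) (w + t * m) := by
        -- reorder `∑_m ∑_w ∑_l ∑_d` to `∑_d ∑_w ∑_l ∑_m`
        calc ∑ m ∈ Icc (1 : ℕ) M, ∑ w ∈ Icc (a' - |t| * M) (b' + |t| * M),
              ∑ l ∈ Icc (1 : ℕ) L, ∑ d ∈ Icc (a - |s| * L) (b + |s| * L),
                G (d + s * l) (w + t * m)
            = ∑ m ∈ Icc (1 : ℕ) M, ∑ w ∈ Icc (a' - |t| * M) (b' + |t| * M),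
                ∑ d ∈ Icc (a - |s| * L) (b + |s| * L), ∑ l ∈ Icc (1 : ℕ) L,
                  G (d + s * l) (w + t * m) :=
              Finset.sum_congr rfl fun m _ => Finset.sum_congr rfl fun w _ => Finset.sum_comm
          _ = ∑ m ∈ Icc (1 : ℕ) M, ∑ d ∈ Icc (a - |s| * L) (b + |s| * L),
                ∑ w ∈ Icc (a' - |t| * M) (b' + |t| * M), ∑ l ∈ Icc (1 : ℕ) L,
                  G (d + s * l) (w + t * m) :=
              Finset.sum_congr rfl fun m _ => Finset.sum_comm
          _ = ∑ d ∈ Icc (a - |s| * L) (b + |s| * L), ∑ m ∈ Icc (1 : ℕ) M,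
                ∑ w ∈ Icc (a' - |t| * M) (b' + |t| * M), ∑ l ∈ Icc (1 : ℕ) L,
                  G (d + s * l) (w + t * m) := Finset.sum_comm
          _ = ∑ d ∈ Icc (a - |s| * L) (b + |s| * L), ∑ w ∈ Icc (a' - |t| * M) (b' + |t| * M),
                ∑ m ∈ Icc (1 : ℕ) M, ∑ l ∈ Icc (1 : ℕ) L, G (d + s * l) (w + t * m) :=
              Finset.sum_congr rfl fun d _ => Finset.sum_comm
          _ = _ := Finset.sum_congr rfl fun d _ => Finset.sum_congr rfl fun w _ => Finset.sum_comm

/-- **Pigeonhole on the two windows**: for `G` vanishing outside `[a,b] × [a',b']` (`a ≤ b`,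
`a' ≤ b'`) there are `d ∈ Wd = [a−|s|L, b+|s|L]`, `w ∈ Ww = [a'−|t|M, b'+|t|M]` with
`L M ‖∑_{[a,b]×[a',b']} G‖ ≤ #Wd · #Ww · ‖∑_{l=1}^{L} ∑_{m=1}^{M} G(d+sl, w+tm)‖`.
[cite: GreenTao2008QuadraticMobius, §10 (proof of Lemma 24, "there exist d, w such that")] -/
theorem exists_large_progression₂ {G : ℤ → ℤ → ℂ} {a b a' b' : ℤ} (hab : a ≤ b) (hab' : a' ≤ b')
    (hG : ∀ d w, (d ∉ Icc a b ∨ w ∉ Icc a' b') → G d w = 0) (s t : ℤ) (L M : ℕ) :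
    ∃ d ∈ Icc (a - |s| * L) (b + |s| * L), ∃ w ∈ Icc (a' - |t| * M) (b' + |t| * M),
      (L : ℝ) * M * ‖∑ d ∈ Icc a b, ∑ w ∈ Icc a' b', G d w‖ ≤
        (#(Icc (a - |s| * L) (b + |s| * L)) : ℝ) * (#(Icc (a' - |t| * M) (b' + |t| * M)) : ℝ) *
          ‖∑ l ∈ Icc (1 : ℕ) L, ∑ m ∈ Icc (1 : ℕ) M, G (d + s * l) (w + t * m)‖ := by
  set Wd := Icc (a - |s| * L) (b + |s| * L) with hWd
  set Ww := Icc (a' - |t| * M) (b' + |t| * M) with hWw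
  have hned : Wd.Nonempty := ⟨a, by
    rw [hWd, mem_Icc]; have : 0 ≤ |s| * (L : ℤ) := by positivity
    constructor <;> linarith⟩
  have hnew : Ww.Nonempty := ⟨a', by
    rw [hWw, mem_Icc]; have : 0 ≤ |t| * (M : ℤ) := by positivity
    constructor <;> linarith⟩
  have hne : (Wd ×ˢ Ww).Nonempty := hned.product hnew
  set Φ : ℤ × ℤ → ℝ := fun p =>
    ‖∑ l ∈ Icc (1 : ℕ) L, ∑ m ∈ Icc (1 : ℕ) M, G (p.1 + s * l) (p.2 + t * m)‖ with hΦ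
  obtain ⟨p₀, hp₀, hmax⟩ := exists_max_image (Wd ×ˢ Ww) Φ hne
  rw [Finset.mem_product] at hp₀
  refine ⟨p₀.1, hp₀.1, p₀.2, hp₀.2, ?_⟩
  have havg := sum_eq_avg_progressions₂ hG s t L M
  have hnorm : (L : ℝ) * M * ‖∑ d ∈ Icc a b, ∑ w ∈ Icc a' b', G d w‖ =
      ‖∑ d ∈ Wd, ∑ w ∈ Ww, ∑ l ∈ Icc (1 : ℕ) L, ∑ m ∈ Icc (1 : ℕ) M,
        G (d + s * l) (w + t * m)‖ := by
    rw [← havg, norm_mul, norm_mul, Complex.norm_natCast, Complex.norm_natCast]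
  rw [hnorm]
  calc ‖∑ d ∈ Wd, ∑ w ∈ Ww, ∑ l ∈ Icc (1 : ℕ) L, ∑ m ∈ Icc (1 : ℕ) M, G (d + s * l) (w + t * m)‖
      ≤ ∑ d ∈ Wd, ‖∑ w ∈ Ww, ∑ l ∈ Icc (1 : ℕ) L, ∑ m ∈ Icc (1 : ℕ) M,
          G (d + s * l) (w + t * m)‖ := norm_sum_le _ _
    _ ≤ ∑ d ∈ Wd, ∑ w ∈ Ww, ‖∑ l ∈ Icc (1 : ℕ) L, ∑ m ∈ Icc (1 : ℕ) M,
          G (d + s * l) (w + t * m)‖ := Finset.sum_le_sum fun d _ => norm_sum_le _ _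
    _ = ∑ p ∈ Wd ×ˢ Ww, Φ p := by rw [Finset.sum_product]
    _ ≤ ∑ _p ∈ Wd ×ˢ Ww, Φ p₀ := Finset.sum_le_sum fun p hp => hmax p hp
    _ = (#Wd : ℝ) * #Ww * Φ p₀ := by
        rw [Finset.sum_const, Finset.card_product, nsmul_eq_mul]; push_cast; ring

end Summit.Parity.GeneralizedHardyLittlewood.GreenTaoLevelTwoMNTwoProgressionAveraging2
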